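import Mathlib
import HarnessLib
import Summits.HubbardSuperconductivity.HubbardSuperconductivity.Theorems.KLProgrammeKLRegimeEnginePairLadderTowerShaped
import Summits.HubbardSuperconductivity.HubbardSuperconductivity.Theorems.KLProgrammeKLRegimeSplitEngineV10

/-!
# Route `KLProgramme` — crux K3, ENGINE child (gen 6 stmt-…-20236 `KLRegimeEngineV16`; gen 7-flow twin at K := K_n), stub `stub_engine_step_values`,
# conjunct (E2-v10) at `1 ≤ n`: scalar discharge tools for the forward composition — the shaped four-term form on a PRODUCT carrier, the leg count of a
# pair entry, and the V10 budget line from shape coefficients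

Cell gate-hubbard-kl, seat hubbard-kl-k3c1-p1 (g7), technique «composed-map remainder propagation».  Companions of `kltc_fourTerm_shaped_le` /
`kltc_tower_budget_shaped` (`…TowerShaped`, p495632) for the doors `pairLadderStepAtV10_of_wickTower_fwd` (p518064) /
`pairLadderStepAtV10_of_scaleFlow(_dressed)` (p519462 / p523369):

* §1 **`kltc_fourTerm_shaped_le_map`** — the shaped four-term bound when the weights live on a carrier `T` (e.g. `S × F`, momenta × frequencies) and
  the shape is read through a map `π : T → S` into the additive group of momenta: `E(x,y) ≤ u + λ_R(πx) + λ_C(πy) + c(φ(πx − πy) + φ(πx + πy − Q))`, masses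
  `Σρ ≤ Z`, `Σρ·λ_R∘π ≤ Λ_R`, `Σρ·λ_C∘π ≤ Λ_C`, angular mass `Σ_b ρ_b φ(πb − c₀) ≤ ε` ⟹ the same closed form as on `S` (this is the INNER level of the scale-flow
  door: the Duhamel four-term `FT_ρ(∫|X|)` and the frequency-localisation term have weights on `S × F`);
* §2 **`legSliceCountT_pair_eq`** — the leg count of a pair entry splits over the four legs:
  `countT n ![k′, Qm−k′, Qm−k, k] = 𝟙_n(k′) + 𝟙_n(Qm−k′) + 𝟙_n(Qm−k) + 𝟙_n(k)` (`𝟙_n(p)` = the window indicator of the reading radius), so `legDressBarQ2·countT`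
  IS a shape `ℓ·(λ(k) + λ(k′))` with `λ(p) = 𝟙_n(p) + 𝟙_n(Qm − p)`;
* §3 **`kltc_budgetLineV10_of_shaped`** — if the composed error at the external entry is bounded by a shape
  `U_f + L_f·(𝟙(k′)+𝟙(Qm−k′)+𝟙(Qm−k)+𝟙(k)) + C_f·(phGain n|k−k′|_𝕋 + phGain n|k+k′−Qm|_𝕋)` with `U_f ≤ drivePBar + eremBar + thermalBar`,
  `L_f ≤ Q.CR((Klam U)² + (Klam|U|)³)`, `C_f ≤ (Klam U)²` and `phGain ≥ 0`, then it is below the (E2-v10) budget line — the LAST hypothesis of the doors,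
  reduced to three scalar inequalities.

Arithmetic only; nothing about the model is asserted.  0 kit.
-/

noncomputable section

namespace Summit.HubbardSuperconductivity.HubbardSuperconductivity.Theorems.KLRegimeSplit

set_option linter.dupNamespace false -- summit = problem name (single-conjunct summit), D-0017

open Finset Literature.MathematicalPhysics.QuantumLattice Literature.Probability.LatticeModels
open Summit.HubbardSuperconductivity.HubbardSuperconductivity.Theorems.KLProgrammeLegKernels

/-! ## §1 The shaped four-term form on a product carrier -/

section ShapedMap

variable {T S : Type*} [Fintype T] [AddCommGroup S]

/-- **Four-term form of a shaped majorant, weights on a carrier `T`, shape through `π : T → S`.**  If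
`E(x,y) ≤ u + λ_R(πx) + λ_C(πy) + c·(φ(πx−πy) + φ(πx+πy−Q))` with `u, c ≥ 0`, `λ_R, λ_C, φ ≥ 0`, `φ` even, and the weight `ρ ≥ 0` on `T` has mass `Σρ ≤ Z`,
leg-weighted masses `Σρ·λ_R∘π ≤ Λ_R`, `Σρ·λ_C∘π ≤ Λ_C` and angular mass `Σ_b ρ_b φ(πb − c₀) ≤ ε` for every centre `c₀ ∈ S`, then for `p, q, r ≥ 0`
`E(x,y) + p·Σ_b E(x,b)ρ_b + q·Σ_a ρ_a E(a,y) + r·Σ_aΣ_b ρ_a E(a,b)ρ_b ≤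
 [u(1 + pZ + qZ + rZ²) + pΛ_C + qΛ_R + rZ(Λ_R + Λ_C) + 2cε(p + q + rZ)] + (1 + pZ)λ_R(πx) + (1 + qZ)λ_C(πy) + c·(φ(πx−πy) + φ(πx+πy−Q))`. -/
theorem kltc_fourTerm_shaped_le_map (π : T → S) (E : T → T → ℝ) (ρ : T → ℝ) (lamR lamC φ : S → ℝ) (Q : S)
    {u c p q r Z Λr Λc ε : ℝ} (hu : 0 ≤ u) (hc : 0 ≤ c) (hp : 0 ≤ p) (hq : 0 ≤ q) (hr : 0 ≤ r)
    (hρ : ∀ a, 0 ≤ ρ a) (hlamR : ∀ a, 0 ≤ lamR a) (hlamC : ∀ a, 0 ≤ lamC a) (hφ0 : ∀ v, 0 ≤ φ v) (hφ : ∀ v, φ (-v) = φ v)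
    (hE : ∀ x y, E x y ≤ u + lamR (π x) + lamC (π y) + c * (φ (π x - π y) + φ (π x + π y - Q)))
    (hZ : ∑ a, ρ a ≤ Z) (hΛr : ∑ a, ρ a * lamR (π a) ≤ Λr) (hΛc : ∑ a, ρ a * lamC (π a) ≤ Λc)
    (hang : ∀ c₀ : S, ∑ b, ρ b * φ (π b - c₀) ≤ ε) (x y : T) :
    E x y + p * ∑ b, E x b * ρ b + q * ∑ a, ρ a * E a y + r * ∑ a, ∑ b, ρ a * E a b * ρ b ≤
      (u * (1 + p * Z + q * Z + r * Z * Z) + p * Λc + q * Λr + r * Z * (Λr + Λc) + 2 * c * ε * (p + q + r * Z)) +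
        (1 + p * Z) * lamR (π x) + (1 + q * Z) * lamC (π y) + c * (φ (π x - π y) + φ (π x + π y - Q)) := by
  have hZ0 : 0 ≤ Z := (sum_nonneg fun a _ => hρ a).trans hZ
  have hε0 : 0 ≤ ε := (sum_nonneg fun b _ => mul_nonneg (hρ b) (hφ0 _)).trans (hang (π x))
  have hΛc0 : 0 ≤ Λc := (sum_nonneg fun a _ => mul_nonneg (hρ a) (hlamC _)).trans hΛc
  -- angular sums at the four centres
  have hang_row1 : ∀ x : T, ∑ b, ρ b * φ (π x - π b) ≤ ε := by
    intro x
    have h := hang (π x)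
    calc ∑ b, ρ b * φ (π x - π b) = ∑ b, ρ b * φ (π b - π x) := sum_congr rfl fun b _ => by rw [← neg_sub, hφ]
      _ ≤ ε := h
  have hang_row2 : ∀ x : T, ∑ b, ρ b * φ (π x + π b - Q) ≤ ε := by
    intro x
    have h := hang (Q - π x)
    calc ∑ b, ρ b * φ (π x + π b - Q) = ∑ b, ρ b * φ (π b - (Q - π x)) := sum_congr rfl fun b _ => by congr 2; abel
      _ ≤ ε := h
  have hang_col1 : ∀ y : T, ∑ a, ρ a * φ (π a - π y) ≤ ε := fun y => hang (π y)
  have hang_col2 : ∀ y : T, ∑ a, ρ a * φ (π a + π y - Q) ≤ ε := by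
    intro y
    have h := hang (Q - π y)
    calc ∑ a, ρ a * φ (π a + π y - Q) = ∑ a, ρ a * φ (π a - (Q - π y)) := sum_congr rfl fun a _ => by congr 2; abel
      _ ≤ ε := h
  -- row sums
  have hrow : ∀ x : T, ∑ b, E x b * ρ b ≤ (u + lamR (π x)) * Z + Λc + 2 * c * ε := by
    intro x
    have hsplit : ∀ b, (u + lamR (π x) + lamC (π b) + c * (φ (π x - π b) + φ (π x + π b - Q))) * ρ b =
        (u + lamR (π x)) * ρ b + ρ b * lamC (π b) + c * (ρ b * φ (π x - π b)) + c * (ρ b * φ (π x + π b - Q)) := fun b => by ring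
    calc ∑ b, E x b * ρ b ≤ ∑ b, (u + lamR (π x) + lamC (π b) + c * (φ (π x - π b) + φ (π x + π b - Q))) * ρ b :=
          sum_le_sum fun b _ => mul_le_mul_of_nonneg_right (hE x b) (hρ b)
      _ = (u + lamR (π x)) * ∑ b, ρ b + ∑ b, ρ b * lamC (π b) + c * ∑ b, ρ b * φ (π x - π b) + c * ∑ b, ρ b * φ (π x + π b - Q) := by
          rw [sum_congr rfl fun b _ => hsplit b, sum_add_distrib, sum_add_distrib, sum_add_distrib, ← mul_sum, ← mul_sum, ← mul_sum]
      _ ≤ (u + lamR (π x)) * Z + Λc + c * ε + c * ε :=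
          add_le_add (add_le_add (add_le_add (mul_le_mul_of_nonneg_left hZ (add_nonneg hu (hlamR _))) hΛc)
            (mul_le_mul_of_nonneg_left (hang_row1 x) hc)) (mul_le_mul_of_nonneg_left (hang_row2 x) hc)
      _ = (u + lamR (π x)) * Z + Λc + 2 * c * ε := by ring
  -- column sums
  have hcol : ∑ a, ρ a * E a y ≤ (u + lamC (π y)) * Z + Λr + 2 * c * ε := by
    have hsplit : ∀ a, ρ a * (u + lamR (π a) + lamC (π y) + c * (φ (π a - π y) + φ (π a + π y - Q))) =
        (u + lamC (π y)) * ρ a + ρ a * lamR (π a) + c * (ρ a * φ (π a - π y)) + c * (ρ a * φ (π a + π y - Q)) := fun a => by ring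
    calc ∑ a, ρ a * E a y ≤ ∑ a, ρ a * (u + lamR (π a) + lamC (π y) + c * (φ (π a - π y) + φ (π a + π y - Q))) :=
          sum_le_sum fun a _ => mul_le_mul_of_nonneg_left (hE a y) (hρ a)
      _ = (u + lamC (π y)) * ∑ a, ρ a + ∑ a, ρ a * lamR (π a) + c * ∑ a, ρ a * φ (π a - π y) + c * ∑ a, ρ a * φ (π a + π y - Q) := by
          rw [sum_congr rfl fun a _ => hsplit a, sum_add_distrib, sum_add_distrib, sum_add_distrib, ← mul_sum, ← mul_sum, ← mul_sum]
      _ ≤ (u + lamC (π y)) * Z + Λr + c * ε + c * ε :=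
          add_le_add (add_le_add (add_le_add (mul_le_mul_of_nonneg_left hZ (add_nonneg hu (hlamC _))) hΛr)
            (mul_le_mul_of_nonneg_left (hang_col1 y) hc)) (mul_le_mul_of_nonneg_left (hang_col2 y) hc)
      _ = (u + lamC (π y)) * Z + Λr + 2 * c * ε := by ring
  -- double sum
  have hdbl : ∑ a, ∑ b, ρ a * E a b * ρ b ≤ u * Z * Z + Z * Λr + Z * (Λc + 2 * c * ε) := by
    calc ∑ a, ∑ b, ρ a * E a b * ρ b = ∑ a, ρ a * ∑ b, E a b * ρ b := by
          refine sum_congr rfl fun a _ => ?_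
          rw [Finset.mul_sum]
          exact sum_congr rfl fun b _ => by ring
      _ ≤ ∑ a, ρ a * ((u + lamR (π a)) * Z + Λc + 2 * c * ε) :=
          sum_le_sum fun a _ => mul_le_mul_of_nonneg_left (hrow a) (hρ a)
      _ = u * Z * ∑ a, ρ a + Z * ∑ a, ρ a * lamR (π a) + (Λc + 2 * c * ε) * ∑ a, ρ a := by
          have hsplit : ∀ a, ρ a * ((u + lamR (π a)) * Z + Λc + 2 * c * ε) =
              u * Z * ρ a + Z * (ρ a * lamR (π a)) + (Λc + 2 * c * ε) * ρ a := fun a => by ring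
          rw [sum_congr rfl fun a _ => hsplit a, sum_add_distrib, sum_add_distrib, ← mul_sum, ← mul_sum, ← mul_sum]
      _ ≤ u * Z * Z + Z * Λr + (Λc + 2 * c * ε) * Z :=
          add_le_add (add_le_add (mul_le_mul_of_nonneg_left hZ (mul_nonneg hu hZ0)) (mul_le_mul_of_nonneg_left hΛr hZ0))
            (mul_le_mul_of_nonneg_left hZ (by positivity))
      _ = u * Z * Z + Z * Λr + Z * (Λc + 2 * c * ε) := by ring
  -- assemble
  have e1 := hE x y
  have e2 : p * ∑ b, E x b * ρ b ≤ p * ((u + lamR (π x)) * Z + Λc + 2 * c * ε) := mul_le_mul_of_nonneg_left (hrow x) hp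
  have e3 : q * ∑ a, ρ a * E a y ≤ q * ((u + lamC (π y)) * Z + Λr + 2 * c * ε) := mul_le_mul_of_nonneg_left hcol hq
  have e4 : r * ∑ a, ∑ b, ρ a * E a b * ρ b ≤ r * (u * Z * Z + Z * Λr + Z * (Λc + 2 * c * ε)) :=
    mul_le_mul_of_nonneg_left hdbl hr
  nlinarith [e1, e2, e3, e4]

end ShapedMap

/-! ## §2 The leg count of a pair entry -/

section Model

variable (L M : ℕ) [NeZero L] [NeZero M]

omit [NeZero L] [NeZero M] in
/-- **The temperature-aware leg count of a pair entry splits over its four legs**: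
`countT n ![k′, Qm−k′, Qm−k, k] = 𝟙_n(k′) + 𝟙_n(Qm−k′) + 𝟙_n(Qm−k) + 𝟙_n(k)`, `𝟙_n(p) = [Λ_{n+2} ≤ t_K(p) ≤ Λ_{n−2}]`. -/
theorem legSliceCountT_pair_eq (β μ : ℝ) (K : TrigPolyC4v) (n : ℕ) (Qm k k' : TorusSite 2 L) :
    (legSliceCountT L β μ K n ![k', Qm - k', Qm - k, k] : ℝ) =
      (if klScale klE0 (n + 2) ≤ klLegRadius L β μ K k' ∧ klLegRadius L β μ K k' ≤ klScale klE0 (n - 2) then 1 else 0) +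
      (if klScale klE0 (n + 2) ≤ klLegRadius L β μ K (Qm - k') ∧ klLegRadius L β μ K (Qm - k') ≤ klScale klE0 (n - 2) then 1 else 0) +
      (if klScale klE0 (n + 2) ≤ klLegRadius L β μ K (Qm - k) ∧ klLegRadius L β μ K (Qm - k) ≤ klScale klE0 (n - 2) then 1 else 0) +
      (if klScale klE0 (n + 2) ≤ klLegRadius L β μ K k ∧ klLegRadius L β μ K k ≤ klScale klE0 (n - 2) then 1 else 0) := by
  classical
  simp only [legSliceCountT, Finset.card_filter, Fin.sum_univ_four, Matrix.cons_val_zero, Matrix.cons_val_one, Matrix.head_cons,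
    Matrix.cons_val_two, Matrix.tail_cons, Matrix.cons_val_three]
  push_cast
  ring

/-! ## §3 The (E2-v10) budget line from shape coefficients -/

omit [NeZero L] [NeZero M] in
/-- **The V10 budget line from three scalar inequalities.**  If the composed error `Tv` at the external entry `(k, k′)` of the pair class `Qm` is
bounded by the shape `U_f + L_f·(𝟙(k′)+𝟙(Qm−k′)+𝟙(Qm−k)+𝟙(k)) + C_f·(phGain n|k−k′|_𝕋 + phGain n|k+k′−Qm|_𝕋)` and
`U_f ≤ drivePBar(n−1) + eremBar(n−1) + thermalBar(n)`, `L_f ≤ Q.CR((Klam U)² + (Klam|U|)³)`, `C_f ≤ (Klam U)²`, `phGain n ≥ 0`, then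
`Tv ≤ drivePBar + eremBar + thermalBar + legDressBarQ2·countT + (Klam U)²(phGain n|k−k′|_𝕋 + phGain n|k+k′−Qm|_𝕋)` — the last hypothesis of
`pairLadderStepAtV10_of_wickTower_fwd` / `…_of_scaleFlow(_dressed)`. -/
theorem kltc_budgetLineV10_of_shaped {G : GeoConsts} {P : SplitConsts} {Q : EngConsts} {β U μ : ℝ} {K : TrigPolyC4v} {n : ℕ}
    {Qm k k' : TorusSite 2 L} {Tv Uf Lf Cf : ℝ} (hph : ∀ ρ, 0 ≤ G.phGain n ρ)
    (hUf : Uf ≤ drivePBar G P U (n - 1) + eremBar G P Q U β L (n - 1) + thermalBar G P U β n)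
    (hLf : Lf ≤ Q.CR * ((P.Klam * U) ^ 2 + (P.Klam * |U|) ^ 3)) (hCf : Cf ≤ (P.Klam * U) ^ 2)
    (hT : Tv ≤ Uf +
      Lf * ((if klScale klE0 (n + 2) ≤ klLegRadius L β μ K k' ∧ klLegRadius L β μ K k' ≤ klScale klE0 (n - 2) then 1 else 0) +
        (if klScale klE0 (n + 2) ≤ klLegRadius L β μ K (Qm - k') ∧ klLegRadius L β μ K (Qm - k') ≤ klScale klE0 (n - 2) then 1 else 0) +
        (if klScale klE0 (n + 2) ≤ klLegRadius L β μ K (Qm - k) ∧ klLegRadius L β μ K (Qm - k) ≤ klScale klE0 (n - 2) then 1 else 0) +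
        (if klScale klE0 (n + 2) ≤ klLegRadius L β μ K k ∧ klLegRadius L β μ K k ≤ klScale klE0 (n - 2) then 1 else 0)) +
      Cf * (G.phGain n (klTorusNorm L (k - k')) + G.phGain n (klTorusNorm L (k + k' - Qm)))) :
    Tv ≤ drivePBar G P U (n - 1) + eremBar G P Q U β L (n - 1) + thermalBar G P U β n +
      legDressBarQ2 G P Q U n (legSliceCountT L β μ K n ![k', Qm - k', Qm - k, k]) +
      (P.Klam * U) ^ 2 * (G.phGain n (klTorusNorm L (k - k')) + G.phGain n (klTorusNorm L (k + k' - Qm))) := by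
  rw [legDressBarQ2_eq, legSliceCountT_pair_eq]
  set cnt : ℝ := (if klScale klE0 (n + 2) ≤ klLegRadius L β μ K k' ∧ klLegRadius L β μ K k' ≤ klScale klE0 (n - 2) then 1 else 0) +
      (if klScale klE0 (n + 2) ≤ klLegRadius L β μ K (Qm - k') ∧ klLegRadius L β μ K (Qm - k') ≤ klScale klE0 (n - 2) then 1 else 0) +
      (if klScale klE0 (n + 2) ≤ klLegRadius L β μ K (Qm - k) ∧ klLegRadius L β μ K (Qm - k) ≤ klScale klE0 (n - 2) then 1 else 0) +
      (if klScale klE0 (n + 2) ≤ klLegRadius L β μ K k ∧ klLegRadius L β μ K k ≤ klScale klE0 (n - 2) then 1 else 0) with hcnt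
  have hcnt0 : 0 ≤ cnt := by
    rw [hcnt]
    have h1 : ∀ P₀ : Prop, ∀ [Decidable P₀], (0 : ℝ) ≤ (if P₀ then 1 else 0) := fun P₀ _ => by split_ifs <;> norm_num
    have := h1 (klScale klE0 (n + 2) ≤ klLegRadius L β μ K k' ∧ klLegRadius L β μ K k' ≤ klScale klE0 (n - 2))
    have := h1 (klScale klE0 (n + 2) ≤ klLegRadius L β μ K (Qm - k') ∧ klLegRadius L β μ K (Qm - k') ≤ klScale klE0 (n - 2))
    have := h1 (klScale klE0 (n + 2) ≤ klLegRadius L β μ K (Qm - k) ∧ klLegRadius L β μ K (Qm - k) ≤ klScale klE0 (n - 2))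
    have := h1 (klScale klE0 (n + 2) ≤ klLegRadius L β μ K k ∧ klLegRadius L β μ K k ≤ klScale klE0 (n - 2))
    linarith
  have hφ0 : 0 ≤ G.phGain n (klTorusNorm L (k - k')) + G.phGain n (klTorusNorm L (k + k' - Qm)) := add_nonneg (hph _) (hph _)
  have e1 : Lf * cnt ≤ Q.CR * ((P.Klam * U) ^ 2 + (P.Klam * |U|) ^ 3) * cnt := mul_le_mul_of_nonneg_right hLf hcnt0
  have e2 : Cf * (G.phGain n (klTorusNorm L (k - k')) + G.phGain n (klTorusNorm L (k + k' - Qm))) ≤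
      (P.Klam * U) ^ 2 * (G.phGain n (klTorusNorm L (k - k')) + G.phGain n (klTorusNorm L (k + k' - Qm))) :=
    mul_le_mul_of_nonneg_right hCf hφ0
  linarith [hT, e1, e2]

end Model

end Summit.HubbardSuperconductivity.HubbardSuperconductivity.Theorems.KLRegimeSplit

end
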